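import Literature.Computability.AlgebraicComplexity.PerDetHwvCertificateWeights
import Literature.Computability.AlgebraicComplexity.PerDetHwvCertificate
import HarnessLib

/-!
# The certificate's points are points of the orbit of the padded permanent

Lean checker of the GCT multiplicity-obstruction engine (cell `pub-gct`; honest framing: rung-1
multiplicity-obstruction search for permanent versus determinant at small `(n, m)`, no claim about
VP ≠ VNP or P ≠ NP), step H1e (second part). The kernel evaluator reads a certificate point as the
sum of products of linear forms `paddedPermPoint n m g` (`PerDetHwvCertificate.lean`): the padded
permanent in the certificate's variables `x_{ij} ↦ i·n + j`, `z ↦ n²`, after the substitution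
`X_v ↦ ∑_w g_{wv} X_w`. Here we identify the FORM this presents, inside the tree's polynomial
ring on the matrix variables `MatIdx m` through the reversed lexicographic enumeration
`matIdxEnum` (`PerDetHwvCertificateWeights.lean`), with a substitution instance of the tree's
padded permanent `paddedPerFormLex K n m` (`SchurWeylPlethysm.lean`):

* `permPolyX K n m = X_{x(n²)}^{m-n} · perm (X_{x(i n + j)})_{i,j<n}` — the padded permanent in
  the enumerated variables — equals `rename ρ (paddedPerFormLex K n m)` for the relabelling `ρ`
  taking the tree's padding variable `(0,0)` to `x(n²)` and the bottom-right block entry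
  `(m-n+i, m-n+j)` to `x(i n + j)` (`rename_rho_paddedPerFormLex`); `rename ρ` is the substitution
  of the matrix `renameMat ρ` (`linSubst_renameMat`);
* `splfPoly_paddedPermPoint`: the form presented by `paddedPermPoint n m g` (read through
  `coefM`/`formM`) is `linSubst (liftMat m g) (permPolyX K n m)`, hence
  `linSubst (liftMat m g * renameMat ρ) (paddedPerFormLex K n m)` — a point `γ · X₀₀^{m-n} per_n`
  of the End-orbit of the padded permanent, as the glue requires.

Elementary [folklore].
-/

noncomputable section

open scoped BigOperators

namespace Literature.Computability.AlgebraicComplexity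

namespace TableauEval

open MvPolynomial
open _root_.Literature.NumberTheory.DiophantineGeometry

variable (K : Type*) [Field K]

/-! ## §1 Renaming as a substitution -/

/-- The `0/1` matrix of a relabelling `ρ` of the variables (`X_v ↦ X_{ρ v}` under `linSubst`).
[folklore] -/
def renameMat {τ : Type*} [DecidableEq τ] (ρ : τ → τ) : Matrix τ τ K :=
  Matrix.of fun w v => if w = ρ v then 1 else 0

/-- `linSubst (renameMat ρ) = rename ρ` (any relabelling, injective or not). [folklore] -/
theorem linSubst_renameMat {τ : Type*} [Fintype τ] [DecidableEq τ] (ρ : τ → τ) :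
    linSubst τ K (renameMat K ρ) = rename ρ := by
  apply MvPolynomial.algHom_ext
  intro v
  rw [linSubst_X, rename_X, Finset.sum_eq_single (ρ v)]
  · simp [renameMat]
  · intro w _ hw; simp [renameMat, hw]
  · intro h; exact absurd (Finset.mem_univ _) h

/-- A ring map sends a permanent to the permanent of the mapped matrix. [folklore] -/
theorem map_permanent {R S F : Type*} [CommRing R] [CommRing S] [FunLike F R S]
    [RingHomClass F R S] {ι : Type*} [Fintype ι] [DecidableEq ι] (f : F) (M : Matrix ι ι R) :
    f M.permanent = (M.map f).permanent := by
  simp [Matrix.permanent, map_sum, map_prod]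

/-! ## §2 The padded permanent in the enumerated variables -/

variable (n m : ℕ) [NeZero m]

/-- Certificate index of a tree matrix variable: bottom-right block entry `(a, b)`
(`a, b ≥ m-n`) ↦ `(a-(m-n))·n + (b-(m-n))`, everything else (in particular the padding variable
`(0,0)` when `n < m`) ↦ `n²`. [folklore] -/
def certIdx (v : MatIdx m) : ℕ :=
  if m - n ≤ ((ofLex v).1 : ℕ) ∧ m - n ≤ ((ofLex v).2 : ℕ) then
    (((ofLex v).1 : ℕ) - (m - n)) * n + (((ofLex v).2 : ℕ) - (m - n))
  else n * n

/-- The relabelling of the tree's variables into the enumerated certificate variables.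
[folklore] -/
def rho (v : MatIdx m) : MatIdx m := (matIdxEnum m).x (certIdx n m v)

/-- **The padded permanent in certificate variables**:
`X_{x(n²)}^{m-n} · perm (X_{x(i n + j)})_{i,j<n}`. [folklore] -/
def permPolyX : MvPolynomial (MatIdx m) K :=
  X ((matIdxEnum m).x (n * n)) ^ (m - n) *
    (Matrix.of fun i j : Fin n => (X ((matIdxEnum m).x ((i : ℕ) * n + j)) :
      MvPolynomial (MatIdx m) K)).permanent

variable {n m}

/-- The bottom-right block as `Fin n` (for `n ≤ m`). [folklore] -/
def blockEquiv (hnm : n ≤ m) : Fin n ≃ BlockIdx n m where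
  toFun i := ⟨⟨m - n + i, by omega⟩, by simp⟩
  invFun b := ⟨(b.1 : ℕ) - (m - n), by have := b.2; have := b.1.isLt; omega⟩
  left_inv i := by ext; simp
  right_inv b := by
    apply Subtype.ext; apply Fin.ext
    have := b.2
    simp only
    omega

/-- **The relabelled tree form is the certificate form**:
`rename ρ (X₀₀^{m-n} per_n) = X_{x(n²)}^{m-n} perm (X_{x(i n + j)})`. [folklore] -/
theorem rename_rho_paddedPerFormLex (hnm : n ≤ m) :
    rename (rho n m) (paddedPerFormLex K n m) = permPolyX K n m := by
  unfold paddedPerFormLex paddedPerPoly permPolyX perPoly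
  rw [rename_rename, map_mul, map_pow, rename_X, rename_rename]
  congr 1
  · -- the padding variable
    by_cases h : n < m
    · have h00 : (rho n m ∘ ⇑toLex) ((0 : Fin m), (0 : Fin m)) = (matIdxEnum m).x (n * n) := by
        show (matIdxEnum m).x (certIdx n m (toLex ((0 : Fin m), (0 : Fin m)))) = _
        unfold certIdx
        rw [ofLex_toLex, if_neg (by intro hc; have := hc.1; simp at this; omega)]
      rw [h00]
    · have h0 : m - n = 0 := by omega
      rw [h0, pow_zero, pow_zero]
  · -- the permanent of the block
    rw [map_permanent]
    -- reindex the block by `Fin n`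
    set e := blockEquiv hnm with he
    unfold Matrix.permanent
    rw [← (Equiv.permCongr e).sum_comp]
    refine Finset.sum_congr rfl fun π _ => ?_
    rw [← e.prod_comp]
    refine Finset.prod_congr rfl fun j _ => ?_
    simp only [Matrix.map_apply, Matrix.of_apply, Matrix.mvPolynomialX,
      rename_X, Function.comp_apply, Equiv.permCongr_apply, Equiv.symm_apply_apply]
    unfold rho certIdx
    congr 2
    simp only [ofLex_toLex, he, blockEquiv, Equiv.coe_fn_mk]
    rw [if_pos ⟨by simp, by simp⟩]
    simp

/-! ## §3 The form presented by a certificate point -/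

/-- The certificate's `k × k` matrix as a matrix on the tree's variables through the enumeration
(`(x w, x v) ↦ g[w][v]`, zero outside). [folklore] -/
def liftMat (m : ℕ) [NeZero m] (g : List (List K)) : Matrix (MatIdx m) (MatIdx m) K :=
  Matrix.of fun a b => (g.getD ((matIdxEnum m).xinv a) []).getD ((matIdxEnum m).xinv b) 0

/-- Reading a column of `g` through the enumeration is the corresponding column of `liftMat`.
[folklore] -/
theorem colOf_getD_xinv (g : List (List K)) {c : ℕ} (hc : c < m * m) (v : MatIdx m) :
    (colOf g c).getD ((matIdxEnum m).xinv v) 0 = liftMat K m g v ((matIdxEnum m).x c) := by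
  unfold colOf liftMat
  rw [Matrix.of_apply, (matIdxEnum m).xinv_x c hc]
  exact getD_map_congr (fun row : List K => row.getD c 0) (d := ([] : List K)) (by simp) g _

/-- The linear form of a column read through the enumeration is the substitution of the
variable. [folklore] -/
theorem linForm_col (g : List (List K)) {c : ℕ} (hc : c < m * m) :
    linForm (fun v => (colOf g c).getD ((matIdxEnum m).xinv v) 0) =
      linSubst (MatIdx m) K (liftMat K m g) (X ((matIdxEnum m).x c)) := by
  rw [linSubst_X, linForm]
  refine Finset.sum_congr rfl fun v _ => ?_
  rw [colOf_getD_xinv K g hc, smul_eq_C_mul]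

/-- Index bound: `i·n + j < n² ≤ m²` for `i, j < n ≤ m`. [folklore] -/
theorem mul_add_lt_sq {i j n m : ℕ} (hi : i < n) (hj : j < n) (hnm : n ≤ m) : i * n + j < m * m := by
  have h1 : i * n + j < (i + 1) * n := by rw [Nat.add_mul, one_mul]; omega
  have h2 : (i + 1) * n ≤ n * n := Nat.mul_le_mul_right n hi
  have h3 : n * n ≤ m * m := Nat.mul_le_mul hnm hnm
  omega

/-- The master lemma for `permsSign (List.range n)`. [folklore] -/
theorem sum_permsSign_range {M : Type*} [AddCommMonoid M] (n : ℕ) (φ : Bool × List ℕ → M) :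
    ((permsSign (List.range n)).map φ).sum =
      ∑ π : Equiv.Perm (Fin n), φ (decide (Equiv.Perm.sign π = -1), List.ofFn fun r => ((π r : Fin n) : ℕ)) := by
  rw [range_eq_ofFn]
  exact sum_permsSign_ofFn _ φ

/-- The product of the linear forms of one term of `paddedPermPoint` (the term of `π`), read
through the enumeration, is the substitution instance of the corresponding monomial. [folklore] -/
theorem prod_linForm_term (hnm : n ≤ m) (g : List (List K)) (π : Equiv.Perm (Fin n)) :
    (∏ s : Fin m, linForm fun v =>
        (((((List.range n).map fun i => colOf g (i * n + (List.ofFn fun r => ((π r : Fin n) : ℕ)).getD i 0))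
          ++ List.replicate (m - n) (colOf g (n * n))).getD s []).getD ((matIdxEnum m).xinv v) 0)) =
      linSubst (MatIdx m) K (liftMat K m g)
        ((∏ i : Fin n, X ((matIdxEnum m).x ((i : ℕ) * n + π i))) *
          X ((matIdxEnum m).x (n * n)) ^ (m - n)) := by
  set forms := ((List.range n).map fun i => colOf g (i * n + (List.ofFn fun r => ((π r : Fin n) : ℕ)).getD i 0))
    ++ List.replicate (m - n) (colOf g (n * n)) with hforms
  have hlen : forms.length = m := by
    rw [hforms, List.length_append, List.length_map, List.length_range, List.length_replicate]
    omega
  have hprod : (∏ s : Fin m, linForm fun v => ((forms.getD s []).getD ((matIdxEnum m).xinv v) 0)) =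
      (forms.map fun f => linForm fun v => f.getD ((matIdxEnum m).xinv v) 0).prod := by
    rw [prod_map_eq_prod_get]
    exact Fintype.prod_equiv (finCongr hlen.symm) _ _ fun s => by
      rw [List.getD_eq_getElem _ _ (by rw [hlen]; exact s.isLt)]; rfl
  rw [hprod, hforms, List.map_append, List.prod_append, List.map_replicate, List.prod_replicate,
    List.map_map, map_mul, map_pow, map_prod]
  congr 1
  · rw [range_eq_ofFn, List.map_ofFn, List.prod_ofFn]
    refine Finset.prod_congr rfl fun i _ => ?_
    have hgi : (List.ofFn fun r => ((π r : Fin n) : ℕ)).getD i 0 = π i := by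
      rw [List.getD_eq_getElem _ _ (by simp), List.getElem_ofFn]
    simp only [Function.comp_apply, hgi]
    exact linForm_col K g (mul_add_lt_sq i.isLt (π i).isLt hnm)
  · by_cases h : n < m
    · rw [linForm_col K g (Nat.mul_lt_mul'' h h)]
    · rw [Nat.sub_eq_zero_of_le (not_lt.mp h), pow_zero, pow_zero]

/-- **The form presented by a certificate point**: reading `paddedPermPoint n m g` through
`coefM`/`formM` presents `linSubst (liftMat m g) (permPolyX K n m)`. [folklore] -/
theorem splfPoly_paddedPermPoint (hnm : n ≤ m) (g : List (List K)) :
    splfPoly (coefM (paddedPermPoint n m g)) (formM (matIdxEnum m) (paddedPermPoint n m g) m) =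
      linSubst (MatIdx m) K (liftMat K m g) (permPolyX K n m) := by
  have h1 : splfPoly (coefM (paddedPermPoint n m g)) (formM (matIdxEnum m) (paddedPermPoint n m g) m)
      = ((paddedPermPoint n m g).terms.map fun t => C t.1 *
          ∏ s : Fin m, linForm fun v => ((t.2.getD s []).getD ((matIdxEnum m).xinv v) 0)).sum := by
    unfold splfPoly coefM formM
    rw [sum_map_eq_sum_get]
  rw [h1]
  unfold paddedPermPoint permsOf
  rw [List.map_map, List.map_map, sum_permsSign_range]
  trans ∑ π : Equiv.Perm (Fin n), linSubst (MatIdx m) K (liftMat K m g)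
      ((∏ i : Fin n, X ((matIdxEnum m).x ((i : ℕ) * n + π i))) *
        X ((matIdxEnum m).x (n * n)) ^ (m - n))
  · refine Finset.sum_congr rfl fun π _ => ?_
    simp only [Function.comp_apply, C_1, one_mul]
    exact prod_linForm_term K hnm g π
  · rw [← map_sum, permPolyX,
      mul_comm (X ((matIdxEnum m).x (n * n)) ^ (m - n) : MvPolynomial (MatIdx m) K),
      ← Matrix.permanent_transpose, Matrix.permanent, Finset.sum_mul]
    rfl

/-- **Certificate points are substitution instances of the tree's padded permanent**:
the presented form is `linSubst (liftMat m g * renameMat ρ) (paddedPerFormLex K n m)`.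
[folklore] -/
theorem splfPoly_paddedPermPoint_eq_linSubst (hnm : n ≤ m) (g : List (List K)) :
    splfPoly (coefM (paddedPermPoint n m g)) (formM (matIdxEnum m) (paddedPermPoint n m g) m) =
      linSubst (MatIdx m) K (liftMat K m g * renameMat K (rho n m)) (paddedPerFormLex K n m) := by
  rw [splfPoly_paddedPermPoint K hnm, linSubst_mul, AlgHom.comp_apply, linSubst_renameMat,
    rename_rho_paddedPerFormLex K hnm]

end TableauEval

end Literature.Computability.AlgebraicComplexity

end
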